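import Summits.NavierStokesRegularity.FluidComputer.PalasekTowerRegisterGlobalHeredity

/-!
# REGISTER v2.3′: the rigid window at the child scale — stretch budget and diffusion number

Cell `ns-blowup`, seat `ns-blowup-ecbridge-5` (g3); sibling of `PalasekTowerRegisterGlobalCoreFloors.lean` and
of §5 of `PalasekTowerRegisterGlobalHalves.lean` (p419350, `Schedule.Rigid.window_mul_ceiling_sq`: the rigid
window in sup-norm scaling units at the HOST scale). LABEL: E–C typing (KERNEL arithmetic of the registered
schedule, every statement proved). WHAT THIS IS NOT: not Navier–Stokes evidence — identities between the
registered constants; no stage, flow or tower is constructed or asserted.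

On a rigid schedule (`τ_{k+1} = τ_k + c₅ log N_{k+1} / A_k`, any rates): the window is `c₅ log N_{k+1}`
host-strain times (`Schedule.Rigid.A_mul_window`); the stretch budget of the host strain through the window
is `exp (A_k (τ_{k+1} - τ_k)) = N_{k+1}^{c₅}` (`Schedule.Rigid.exp_A_mul_window`; `c₅ = 4bβ` under
rigidity); and the window in diffusion units at the CHILD scale is
`(τ_{k+1} - τ_k) · N_{k+1}² = c₅ log N_{k+1} · N_k^{2b-β}` (`Schedule.Rigid.window_mul_N_succ_sq`, unit
viscosity): DC1 `2b < β` makes the exponent negative (`Schedule.Rigid.two_b_sub_β_neg`) — eventually the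
window is short against the diffusion time `N_{k+1}^{-2}` of a structure of size `1/N_{k+1}` — but on the
wide rates the exponent is only `-1/10` (`Schedule.Rigid.two_b_sub_β_wide`), so the prefactor
`c₅ log N_{k+1}` dominates for every level of practical depth (refuter4's «viscous spreading in `w_k`»,
STAMP note on item 19250, in kernel form).

References: S. Palasek, arXiv:2605.13827 §3.1 (3.2), §3.3 [cite: Palasek2026ElementaryModel, §3].
-/

noncomputable section

namespace Summit.NavierStokesRegularity.FluidComputer.PalasekTowerClayBridge

open Set MeasureTheory Filter Topology Function Real
open scoped ENNReal ContDiff NNReal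
open Literature.Analysis.FluidPDE

/-! ## The rigid window at the child scale -/

namespace Schedule.Rigid

variable {R : TowerRates} {S : Schedule R}

/-- **The rigid window is `c₅ log N_{k+1}` host-strain times**: `A_k (τ_{k+1} - τ_k) = c₅ log N_{k+1}`.
[cite: Palasek2026ElementaryModel, §3.3] -/
theorem A_mul_window (h : S.Rigid) (k : ℕ) :
    R.A k * (S.τ (k + 1) - S.τ k) = S.c₅ * Real.log (R.N (k + 1)) := by
  have hA := R.A_pos k
  rw [h.window_eq k]
  field_simp
  ring

/-- **Stretch budget of the host strain through the rigid window**: `exp (A_k (τ_{k+1} - τ_k)) = N_{k+1}^{c₅}`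
(with `c₅ = 4bβ` under rigidity: the level-`k` strain, acting for the whole window, stretches material by
the factor `N_{k+1}^{4bβ}`). [cite: Palasek2026ElementaryModel, §3.3] -/
theorem exp_A_mul_window (h : S.Rigid) (k : ℕ) :
    Real.exp (R.A k * (S.τ (k + 1) - S.τ k)) = R.N (k + 1) ^ S.c₅ := by
  rw [h.A_mul_window k, Real.rpow_def_of_pos (R.N_pos (k + 1)), mul_comm]

/-- **The rigid window in diffusion units at the CHILD scale** (unit viscosity): `(τ_{k+1} - τ_k) · N_{k+1}²
= c₅ log N_{k+1} · N_k^{2b-β}`. By DC1 (`2b < β`) the exponent is negative — the window is eventually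
short compared with the diffusion time `N_{k+1}^{-2}` of a structure of size `1/N_{k+1}` — but only
eventually: on the wide rates the exponent is `-1/10`. [cite: Palasek2026ElementaryModel, §3.1 (3.2)] -/
theorem window_mul_N_succ_sq (h : S.Rigid) (k : ℕ) :
    (S.τ (k + 1) - S.τ k) * R.N (k + 1) ^ 2 =
      S.c₅ * Real.log (R.N (k + 1)) * R.N k ^ (2 * R.b - R.β) := by
  have hN := R.N_pos k
  have hw : S.τ (k + 1) - S.τ k = S.c₅ * Real.log (R.N (k + 1)) / R.A k := by
    rw [h.window_eq k]; ring
  have hsq : R.N (k + 1) ^ 2 = R.N k ^ (2 * R.b) := by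
    rw [R.N_succ k, ← Real.rpow_natCast (R.N k ^ R.b) 2, ← Real.rpow_mul hN.le]
    norm_num
    ring_nf
  rw [hw, hsq, Real.rpow_sub hN]
  show S.c₅ * Real.log (R.N (k + 1)) / R.N k ^ R.β * R.N k ^ (2 * R.b) =
    S.c₅ * Real.log (R.N (k + 1)) * (R.N k ^ (2 * R.b) / R.N k ^ R.β)
  ring

/-- The exponent `2b - β` of `window_mul_N_succ_sq` is negative (DC1). [cite: Palasek2026ElementaryModel, §3.1 (3.2)] -/
theorem two_b_sub_β_neg (R : TowerRates) : 2 * R.b - R.β < 0 := by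
  linarith [R.two_b_lt_β]

/-- On the wide rates the exponent is `-1/10` (`b = 11/10`, `β = 23/10`). [folklore] -/
theorem two_b_sub_β_wide : 2 * TowerRates.wide.b - TowerRates.wide.β = -(1 / 10) := by
  show 2 * ((11 : ℝ) / 10) - 23 / 10 = -(1 / 10)
  norm_num

end Schedule.Rigid

/-! ## Appendix (v2, append-only): the diffusion number BY VALUE on the wide rates

`N_k = 2^{8 (11/10)^k}`, so on a rigid wide schedule `(τ_{k+1} - τ_k) · N_{k+1}² =
(1012/100) · 8 (11/10)^{k+1} log 2 · 2^{-(8/10)(11/10)^k}` (`window_mul_N_succ_sq_wide`); by value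
`36 < (τ₂ - τ₁) N₂² < 38` (`window_mul_N_succ_sq_one`, the window of the first rung `HeredityAtOne`) and
`37 < (τ₃ - τ₂) N₃² < 39` (`window_mul_N_succ_sq_two`, the first window of `HeredityFrom 2`) — the number
has not started to decay at the registered levels (the factor `log N_{k+1}` gains `11/10` per level while
`N_k^{-1/10} = 2^{-(8/10)(11/10)^k}` loses only `2^{-(8/100)(11/10)^k}`), although it tends to `0`
(`tendsto_window_mul_N_succ_sq`, DC1). Reading: at every level of practical depth the rigid window is
≈ 37–41 diffusion times of the child core radius (≈ 6 radii of viscous spreading), so a child-scale structure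
present at `τ_{k+1}` must be maintained by the host strain up to the readout (Burgers radius
`A_k^{-1/2} = N_k^{-23/20}` against the child radius `N_k^{-11/10}`: margin `N_k^{1/20}`, `= 256^{11/200} ≈ 1.36`
at `k = 1`). -/

namespace TowerRates

/-- The wide scales in base `2`: `N_k = 2^{8 (11/10)^k}`. [folklore] -/
theorem wide_N_eq_two_rpow (k : ℕ) : wide.N k = (2 : ℝ) ^ (8 * (11 / 10 : ℝ) ^ k) := by
  show (256 : ℝ) ^ ((11 / 10 : ℝ) ^ k) = (2 : ℝ) ^ (8 * (11 / 10 : ℝ) ^ k)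
  rw [show (256 : ℝ) = (2 : ℝ) ^ (8 : ℝ) by norm_num, ← Real.rpow_mul (by norm_num : (0 : ℝ) ≤ 2)]

/-- `log N_k = 8 (11/10)^k log 2` on the wide rates. [folklore] -/
theorem log_wide_N (k : ℕ) : Real.log (wide.N k) = 8 * (11 / 10 : ℝ) ^ k * Real.log 2 := by
  rw [wide_N_eq_two_rpow, Real.log_rpow (by norm_num : (0 : ℝ) < 2)]

end TowerRates

namespace Schedule.Rigid

/-- **The diffusion number in closed form on the wide rates**: for a rigid schedule,
`(τ_{k+1} - τ_k) · N_{k+1}² = (1012/100) · (8 (11/10)^{k+1} log 2) · 2^{-(8/10)(11/10)^k}`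
(`c₅ = 4bβ = 1012/100`, `log N_{k+1} = 8 (11/10)^{k+1} log 2`, `N_k^{2b-β} = 2^{-(8/10)(11/10)^k}`).
[cite: Palasek2026ElementaryModel, §3.1 (3.2)] -/
theorem window_mul_N_succ_sq_wide {S : Schedule TowerRates.wide} (h : S.Rigid) (k : ℕ) :
    (S.τ (k + 1) - S.τ k) * TowerRates.wide.N (k + 1) ^ 2 =
      1012 / 100 * (8 * (11 / 10 : ℝ) ^ (k + 1) * Real.log 2) *
        (2 : ℝ) ^ (-(8 / 10 * (11 / 10 : ℝ) ^ k)) := by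
  rw [h.window_mul_N_succ_sq k, h.c₅_eq, TowerRates.log_wide_N, two_b_sub_β_wide,
    TowerRates.wide_N_eq_two_rpow, ← Real.rpow_mul (by norm_num : (0 : ℝ) ≤ 2)]
  have hb : TowerRates.wide.b = 11 / 10 := rfl
  have hβ : TowerRates.wide.β = 23 / 10 := rfl
  rw [hb, hβ]
  congr 1
  · norm_num
  · congr 1
    ring

/-- `2^{-22/25} ∈ (54/100, 55/100)` (compare 25-th powers). [folklore] -/
theorem two_rpow_neg_088_bounds :
    54 / 100 < (2 : ℝ) ^ (-(88 / 100 : ℝ)) ∧ (2 : ℝ) ^ (-(88 / 100 : ℝ)) < 55 / 100 := by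
  have h2 : (0 : ℝ) ≤ 2 := by norm_num
  have hpow : ((2 : ℝ) ^ (88 / 100 : ℝ)) ^ 25 = 2 ^ (22 : ℕ) := by
    rw [← Real.rpow_natCast ((2 : ℝ) ^ (88 / 100 : ℝ)) 25, ← Real.rpow_mul h2]
    norm_num
  have hpos : 0 < (2 : ℝ) ^ (88 / 100 : ℝ) := Real.rpow_pos_of_pos (by norm_num) _
  -- upper bound on 2^{0.88}: (100/54)
  have hup : (2 : ℝ) ^ (88 / 100 : ℝ) < 100 / 54 := by
    by_contra hle
    have hle' : (100 / 54 : ℝ) ≤ (2 : ℝ) ^ (88 / 100 : ℝ) := not_lt.1 hle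
    have := pow_le_pow_left₀ (by norm_num) hle' 25
    rw [hpow] at this
    norm_num at this
  -- lower bound on 2^{0.88}: (100/55)
  have hlo : (100 / 55 : ℝ) < (2 : ℝ) ^ (88 / 100 : ℝ) := by
    by_contra hle
    have hle' : (2 : ℝ) ^ (88 / 100 : ℝ) ≤ 100 / 55 := not_lt.1 hle
    have := pow_le_pow_left₀ hpos.le hle' 25
    rw [hpow] at this
    norm_num at this
  rw [Real.rpow_neg h2]
  constructor
  · rw [lt_inv_comm₀ (by norm_num) hpos]
    calc (2 : ℝ) ^ (88 / 100 : ℝ) < 100 / 54 := hup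
      _ = (54 / 100)⁻¹ := by norm_num
  · rw [inv_lt_comm₀ hpos (by norm_num)]
    calc (55 / 100 : ℝ)⁻¹ = 100 / 55 := by norm_num
      _ < (2 : ℝ) ^ (88 / 100 : ℝ) := hlo

/-- `2^{-121/125} ∈ (1/2, 513/1000)` (compare with `2^{-1}` and 125-th powers). [folklore] -/
theorem two_rpow_neg_0968_bounds :
    1 / 2 < (2 : ℝ) ^ (-(968 / 1000 : ℝ)) ∧ (2 : ℝ) ^ (-(968 / 1000 : ℝ)) < 513 / 1000 := by
  have h2 : (0 : ℝ) ≤ 2 := by norm_num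
  have hpos : 0 < (2 : ℝ) ^ (968 / 1000 : ℝ) := Real.rpow_pos_of_pos (by norm_num) _
  have hpow : ((2 : ℝ) ^ (968 / 1000 : ℝ)) ^ 125 = 2 ^ (121 : ℕ) := by
    rw [← Real.rpow_natCast ((2 : ℝ) ^ (968 / 1000 : ℝ)) 125, ← Real.rpow_mul h2]
    norm_num
  have hup : (2 : ℝ) ^ (968 / 1000 : ℝ) < 2 := by
    conv_rhs => rw [← Real.rpow_one 2]
    exact Real.rpow_lt_rpow_of_exponent_lt (by norm_num) (by norm_num)
  have hlo : (1000 / 513 : ℝ) < (2 : ℝ) ^ (968 / 1000 : ℝ) := by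
    by_contra hle
    have hle' : (2 : ℝ) ^ (968 / 1000 : ℝ) ≤ 1000 / 513 := not_lt.1 hle
    have := pow_le_pow_left₀ hpos.le hle' 125
    rw [hpow] at this
    norm_num at this
  rw [Real.rpow_neg h2]
  constructor
  · rw [lt_inv_comm₀ (by norm_num) hpos]
    calc (2 : ℝ) ^ (968 / 1000 : ℝ) < 2 := hup
      _ = (1 / 2)⁻¹ := by norm_num
  · rw [inv_lt_comm₀ hpos (by norm_num)]
    calc (513 / 1000 : ℝ)⁻¹ = 1000 / 513 := by norm_num
      _ < (2 : ℝ) ^ (968 / 1000 : ℝ) := hlo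

/-- **The first generic hand-over by value** (`k = 1`, i.e. the window `[τ₁, τ₂]` of the first rung
`HeredityAtOne`): `36 < (τ₂ - τ₁) · N₂² < 38` on a rigid wide schedule — the rigid window is ≈ 37 diffusion
times of the child core radius `1/N₂` (about six radii of viscous spreading). [cite: Palasek2026ElementaryModel, §3.1 (3.2)] -/
theorem window_mul_N_succ_sq_one {S : Schedule TowerRates.wide} (h : S.Rigid) :
    36 < (S.τ 2 - S.τ 1) * TowerRates.wide.N 2 ^ 2 ∧ (S.τ 2 - S.τ 1) * TowerRates.wide.N 2 ^ 2 < 38 := by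
  have hv := h.window_mul_N_succ_sq_wide 1
  rw [show (1 : ℕ) + 1 = 2 from rfl] at hv
  have he : -(8 / 10 * (11 / 10 : ℝ) ^ 1) = -(88 / 100 : ℝ) := by norm_num
  rw [he] at hv
  rw [hv]
  obtain ⟨hl2, hu2⟩ := two_rpow_neg_088_bounds
  have hlg := Real.log_two_gt_d9
  have hll := Real.log_two_lt_d9
  constructor
  · nlinarith [mul_pos (sub_pos.2 hlg) (sub_pos.2 hl2)]
  · nlinarith [mul_pos (sub_pos.2 hll) (sub_pos.2 hu2)]

/-- **The second hand-over by value** (`k = 2`, the first level of `HeredityFrom 2`):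
`37 < (τ₃ - τ₂) · N₃² < 39` — the diffusion number has NOT decreased from `k = 1` (the factor `log N_{k+1}`
grows by `11/10` per level while `N_k^{-1/10}` decays by `2^{-(8/100)(11/10)^k}` only).
[cite: Palasek2026ElementaryModel, §3.1 (3.2)] -/
theorem window_mul_N_succ_sq_two {S : Schedule TowerRates.wide} (h : S.Rigid) :
    37 < (S.τ 3 - S.τ 2) * TowerRates.wide.N 3 ^ 2 ∧ (S.τ 3 - S.τ 2) * TowerRates.wide.N 3 ^ 2 < 39 := by
  have hv := h.window_mul_N_succ_sq_wide 2
  rw [show (2 : ℕ) + 1 = 3 from rfl] at hv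
  have he : -(8 / 10 * (11 / 10 : ℝ) ^ 2) = -(968 / 1000 : ℝ) := by norm_num
  rw [he] at hv
  rw [hv]
  obtain ⟨hl2, hu2⟩ := two_rpow_neg_0968_bounds
  have hlg := Real.log_two_gt_d9
  have hll := Real.log_two_lt_d9
  constructor
  · nlinarith [mul_pos (sub_pos.2 hlg) (sub_pos.2 hl2)]
  · nlinarith [mul_pos (sub_pos.2 hll) (sub_pos.2 hu2)]

/-- **Asymptotically the diffusion number vanishes** (DC1): on a rigid wide schedule
`(τ_{k+1} - τ_k) · N_{k+1}² → 0` as `k → ∞` — super-exponential decay of `N_k^{-1/10}` beats the geometric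
growth of `log N_{k+1}`; by `window_mul_N_succ_sq_one/two` the decay has not begun at the first levels.
[cite: Palasek2026ElementaryModel, §3.1 (3.2)] -/
theorem tendsto_window_mul_N_succ_sq {S : Schedule TowerRates.wide} (h : S.Rigid) :
    Tendsto (fun k : ℕ => (S.τ (k + 1) - S.τ k) * TowerRates.wide.N (k + 1) ^ 2) atTop (𝓝 0) := by
  have hform : ∀ k : ℕ, (S.τ (k + 1) - S.τ k) * TowerRates.wide.N (k + 1) ^ 2 =
      (1012 / 100 * 8 * (11 / 10) * Real.log 2 / (8 / 10 * Real.log 2)) *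
        (((8 / 10 * Real.log 2) * (11 / 10 : ℝ) ^ k) ^ (1 : ℕ) *
          Real.exp (-((8 / 10 * Real.log 2) * (11 / 10 : ℝ) ^ k))) := by
    intro k
    rw [h.window_mul_N_succ_sq_wide k, Real.rpow_def_of_pos (by norm_num : (0 : ℝ) < 2)]
    have hl : Real.log 2 ≠ 0 := by
      have := Real.log_two_gt_d9; positivity
    rw [pow_one, pow_succ]
    field_simp
  simp_rw [hform]
  rw [← mul_zero (1012 / 100 * 8 * (11 / 10) * Real.log 2 / (8 / 10 * Real.log 2) : ℝ)]
  refine Tendsto.const_mul _ ?_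
  have hx : Tendsto (fun k : ℕ => (8 / 10 * Real.log 2) * (11 / 10 : ℝ) ^ k) atTop atTop := by
    refine Tendsto.const_mul_atTop (by have := Real.log_two_gt_d9; positivity) ?_
    exact tendsto_pow_atTop_atTop_of_one_lt (by norm_num)
  exact (Real.tendsto_pow_mul_exp_neg_atTop_nhds_zero 1).comp hx

end Schedule.Rigid

end Summit.NavierStokesRegularity.FluidComputer.PalasekTowerClayBridge

end
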